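import Literature.Analysis.FluidPDE.FractionalNSTorus
import Literature.Analysis.FluidPDE.NSLerayHopf
import HarnessLib

/-!
# Barrier: Leray(–Hopf) solutions are not unique when the dissipation is weak (α < 1/3)

Barrier catalogue `Literature/Barriers/NavierStokesRegularity/` (D-0021), entry for
`NavierStokesRegularity/NavierStokesRegularity`. The fractional Navier–Stokes system
`∂ₜv + div(v⊗v) + ∇p + (-Δ)^α v = 0`, `div v = 0` on `𝕋³` interpolates between Euler (`α = 0`)
and Navier–Stokes (`α = 1`); Leray's construction produces global weak solutions obeying the
energy inequality for every `α ∈ ]0,1[`. The theorems vendored here say that for `α < 1/3` this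
energy-inequality class does **not** single out one solution.

## What the sources print

* Colombo–De Lellis–De Rosa 2018 (held arXiv text, §1 pp. 3–4). Setting: (NS) on `𝕋³ × [0,1]`
  with `α ∈ ]0,1[`, `(-Δ)^α` the Fourier multiplier `|k|^{2α}`. Thm. 1.1: "For any `v̄ ∈ L²(𝕋³)`
  with `div v̄ = 0` and every `α ∈ ]0,1[` there is a weak solution
  `u ∈ L^∞(ℝ⁺, L²(𝕋³)) ∩ L²(ℝ⁺, H^α(𝕋³))` of (NS) such that `v(·,0) = v̄`" and the energy
  inequality (2) from time `0` holds for all `t ≥ 0`; weak solution with datum = the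
  distributional identity against smooth divergence-free `φ ∈ C^∞_c(𝕋³ × ℝ, ℝ³)` with the datum
  term; Leray's solutions also satisfy (3), the energy inequality from a.e. `s` to every `t > s`;
  "solutions of the Cauchy problem … satisfying (2) and (3) will be called Leray solutions".
  **Thm. 1.2:** "Let `α < 1/5`. Then there are initial data `v̄ ∈ L²(𝕋³)` with `div v̄ = 0` for
  which there exist infinitely many Leray solutions `v` of (NS) with `v(·,0) = v̄`." Thm. 1.3:
  the Hölder version (`v̄ ∈ C^β`, `α < β < 1/5`; infinitely many `C^β` solutions on `[0,T]`
  satisfying (3) for all `0 ≤ s ≤ t ≤ T`), extended past `T` by Thm. 1.1; the iteration "works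
  indeed when the exponent `α` is smaller than `1/2`, in particular it yields infinitely many weak
  solutions even in the range `α ∈ [1/5, 1/2[`", but without the energy inequalities; "In the
  remarkable works [JS-Inv, JS] the authors have conjectured (and given strong evidence) that even
  Leray solutions of the classical Navier–Stokes equations (namely with `α = 1`) are not unique.
  However, the mechanism suggested in [JS] is entirely different from the one exploited here."
* De Rosa 2019 (held arXiv text, §1 p. 3). Leray–Hopf weak solutions of (NS_γ):
  `v ∈ L^∞(ℝ⁺,L²) ∩ L²(ℝ⁺,H^γ)`, distributional with datum, "obeying to the global energy
  inequality" (2) "`∀ 0 ≤ s < t`"; Thm. 1.1 (existence for all `γ ∈ ]0,1[`, from CDLDR);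
  "in [CDLDR2017] the authors proved the ill-posedness in the case `γ < 1/5`. The question about
  uniqueness is still open if `γ ≥ 1/5`. In this work we partially answer this question, proving
  the non-uniqueness of such solutions in the range `0 < γ < 1/3`." **Thm. 1.2:** "Let `γ < 1/3`.
  Then there are initial data `v̄ ∈ L²(𝕋³)` with `div v̄ = 0` for which there exist infinitely many
  Leray solutions `v` of (NS_γ) in `[0,+∞) × 𝕋³`. More precisely, if `γ < β < 1/3`, there are
  initial data `v̄ ∈ C^β(𝕋³)` … and a positive time `T` such that (a) there are infinitely many
  Leray–Hopf solutions … `v ∈ C^β(𝕋³ × [0,T])`; (b) such solutions strictly dissipate the total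
  energy in `[0,T]`"; in the range `1/3 ≤ γ < 1/2` the methods give infinitely many weak solutions
  bounded in `L^∞(ℝ⁺,L²)` "but (a priori) without any control on `e_tot`"; the solutions of
  Buckmaster–Vicol (`γ = 1`) "do not even have finite energy dissipation … thus they are not of
  Leray–Hopf type".
* Luo–Titi 2020, §1: J.-L. Lions showed existence and uniqueness of weak solutions, with the
  energy equality, for `θ ∈ [5/4, ∞)`.

## Audit 2026-08-16 (refuter barrier audit, D-0021): formal fact confirmed, claimed coverage narrowed

* **Formal content: a kernel theorem.** `DeRosa2019_thm12` (hence `HypodissipativeLerayNonuniqueness`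
  and `ColomboDeLellisDeRosa2018_thm12`) is PROVED in the tree — `DeRosa2019_thm12_holds`
  (`HypodissipativeLerayNonuniquenessDeRosaHolds.lean`, axioms `propext`/`Classical.choice`/
  `Quot.sound`), as is the local Hölder theorem `ColomboDeLellisDeRosa2018_thm13_holds`
  (`…CDLDRHolds.lean`); the transcription is weaker than print (CDLDR's Leray class, energy
  inequality (3) from a.e. `s`, in place of De Rosa's "`∀ 0 ≤ s < t`") and has no junk witness
  (rich divergence-free test class, local square integrability, zero datum forces zero).
* **Coverage narrowed in two layers** (companion `HypodissipativeLerayNonuniquenessNarrow.lean`,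
  theorems `HypodissipativeLerayNonuniquenessNarrow`, `hypodissipativeLerayNonuniqueness_not_unique`,
  `HypodissipativeLerayNonuniquenessNarrow_local`, which state the exact refuted uniqueness
  principles). (1) The theorems refute UNIQUENESS from general (rough) data only: the wild data
  are `C^β`, `α < β < 1/3`, i.e. supercritical (`β + 2α < 1`), and the distinct solutions separate
  at times accumulating at `0` (De Rosa 2019, §2 p. 5, property (v)); weak–strong uniqueness by
  relative energy — which uses exactly the weak formulation and the energy inequality from `0`,
  and holds with no dissipation at all (Wiedemann 2018, Thm. 1) — is an exponent-blind
  energy-class argument that is TRUE, so the technique class must be read "for data from which no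
  strong solution emanates", and the `blocks:` remark on the route "global regularity ⇒
  uniqueness via weak–strong uniqueness" concerns uniqueness FROM SMOOTH DATA, which these
  theorems do not refute at any `α`. (2) "(or a selection principle)" / the tag
  `leray-hopf-energy-inequality-selection` overstate the entry: non-uniqueness is printed, the
  failure of an energy-based selection rule is not (the scheme realises every admissible energy
  profile from one datum, De Rosa 2019 Thm. 2.1, but no two constructed solutions are shown to
  share a profile, and no limit procedure is shown non-selective).
* **Not a gap.** Local-energy-inequality / suitable-solution arguments are outside the class:
  below `s = 3/4` the local energy inequality cannot be formulated in the energy class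
  (Kwon–Ożański 2022, §1 p. 6), so they use the strength of the dissipation.
* **Scope updates.** Unforced on `𝕋³`: `α < 1/3` remains the state of the art (Lange–Rehmeier–
  Schenke 2024, §1), with `L²`-DENSE wild `C^β` data inside that range (Gorini 2023, §1); with a
  force the threshold disappears (Albritton–Colombo 2023, Thm. 1.1: all orders `< 1` of `Λ^β` on
  `ℝ²`; Khor–Miao–Su 2023, Thm. 1.2: `α ∈ (1/2, 5/4)` on `ℝ³`; Albritton–Brué–Colombo 2022:
  `α = 1`); for `α = 1` unforced only the unrefereed computer-assisted claim recorded at ns.S19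
  (Hou–Wang–Yang 2025).

## Formal content

Named facts (not proved here): `ColomboDeLellisDeRosa2018_thm12` and `DeRosa2019_thm12`, the first
sentences of the two Theorems 1.2 in the solution notions of
`Literature/Analysis/FluidPDE/FractionalNSTorus` (`Torus.IsLerayFracSolution`,
`Torus.HasInfinitelyManyLeraySolutions`; unit-torus normalisation, see that file), and the
catalogue entry `HypodissipativeLerayNonuniqueness := DeRosa2019_thm12`, with the proved
implication to the Colombo–De Lellis–De Rosa range (`1/5 < 1/3`).

## References

* M. Colombo, C. De Lellis, L. De Rosa, Comm. Math. Phys. 362 (2018), 659–688, §1 Thms. 1.1–1.3.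
  [`ColomboDelellisDerosa2018`]
* L. De Rosa, Comm. PDE 44 (2019), 335–365, §1 Thms. 1.1–1.2. [`Derosa2018`]
* T. Luo, E. S. Titi, Calc. Var. PDE 59 (2020), §1. [`LuoTiti2020`]
* H. Jia, V. Šverák, J. Funct. Anal. 268 (2015). [`JiaSverak2015`]
* T. Buckmaster, V. Vicol, Ann. of Math. 189 (2019). [`BuckmasterVicol2019AnnMath`]
* D. Albritton, E. Brué, M. Colombo, Ann. of Math. 196 (2022). [`AlbrittonBrueColombo2022AnnMath`]
* (audit) E. Wiedemann, LMS Lecture Note Ser. 452 (2018), 289–326, Thm. 1. [`Wiedemann2018`];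
  M. Gorini, J. Funct. Anal. 284 (2023), 109819. [`Gorini2023`]; H. Kwon, W. S. Ożański,
  J. Funct. Anal. 282 (2022), 109370. [`KwonOzanski2022`]; A. Bulut, M. K. Huynh, S. Palasek,
  arXiv:2201.05600. [`BulutHuynhPalasek2022`]; T. Lange, M. Rehmeier, A. Schenke,
  arXiv:2412.16532. [`LangeRehmeierSchenke2024`]; D. Albritton, M. Colombo, Comm. Math. Phys.
  402 (2023). [`AlbrittonColombo2023`]; C. Khor, C. Miao, X. Su, Bull. Lond. Math. Soc. 55
  (2023). [`KhorMiaoSu2023`]; T. Y. Hou, Y. Wang, C. Yang, arXiv:2509.25116. [`HouWangYang2025`]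
-/

noncomputable section

open MeasureTheory Set
open scoped ENNReal

namespace Literature.Barriers.NavierStokesRegularity

local notation "𝕋³" => UnitAddTorus (Fin 3)
local notation "ℝ³" => EuclideanSpace ℝ (Fin 3)

/-- **Colombo–De Lellis–De Rosa 2018, Thm. 1.2** (first statement, as printed): "Let `α < 1/5`.
Then there are initial data `v̄ ∈ L²(𝕋³)` with `div v̄ = 0` for which there exist infinitely many
Leray solutions `v` of (NS) with `v(·, 0) = v̄`." Here `α ∈ ]0,1[` is the exponent of the
dissipation `(-Δ)^α` (the paper's standing range), `div v̄ = 0` is the weak divergence-free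
condition for an `L²` field, Leray solutions are `Torus.IsLerayFracSolution α` (the paper's
definition: distributional solution with datum in `L^∞L² ∩ L²H^α` — the latter read locally in
time, see `FractionalNSTorus` — obeying the energy inequalities (2), (3); viscosity `1`), and
"infinitely many" is `Torus.HasInfinitelyManyLeraySolutions` (a sequence of Leray solutions from
`v̄`, pairwise distinct modulo space-time null sets: `∫₀^∞∫‖v_m - v_n‖² ≠ 0`; the source's
solutions are a.e.-defined objects, "redefined on a set of measure zero" to be weakly continuous,
§1 p. 3). Unit-torus normalisation of the in-tree torus files (equivalent by scaling, see
`FractionalNSTorus`). [cite: ColomboDelellisDerosa2018, §1 Thm. 1.2 and p. 3] -/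
def ColomboDeLellisDeRosa2018_thm12 : Prop :=
  ∀ α : ℝ, 0 < α → α < 1 / 5 →
    ∃ u₀ : 𝕋³ → ℝ³, MemLp u₀ 2 volume ∧ Literature.Analysis.FunctionSpaces.Torus.IsWeaklyDivFree u₀ ∧
      Literature.Analysis.FluidPDE.Torus.HasInfinitelyManyLeraySolutions α u₀

/-- **De Rosa 2019, Thm. 1.2** (first statement, as printed): "Let `γ < 1/3`. Then there are
initial data `v̄ ∈ L²(𝕋³)` with `div v̄ = 0` for which there exist infinitely many Leray solutions
`v` of (NS_γ) in `[0,+∞) × 𝕋³`." (`γ ∈ (0, 1/3)`; Leray solutions and "infinitely many" as in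
`ColomboDeLellisDeRosa2018_thm12` — De Rosa's Leray–Hopf solutions, with the energy inequality
for all `0 ≤ s < t`, are in particular Leray solutions in this sense,
`Torus.IsLerayHopfFracSolution.isLerayFracSolution`; the refinements (a) `C^β` data and
solutions, (b) strictly decreasing total energy on `[0,T]`, are not transcribed.)
[cite: Derosa2018, §1 Thm. 1.2] -/
def DeRosa2019_thm12 : Prop :=
  ∀ α : ℝ, 0 < α → α < 1 / 3 →
    ∃ u₀ : 𝕋³ → ℝ³, MemLp u₀ 2 volume ∧ Literature.Analysis.FunctionSpaces.Torus.IsWeaklyDivFree u₀ ∧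
      Literature.Analysis.FluidPDE.Torus.HasInfinitelyManyLeraySolutions α u₀

/-- De Rosa's range contains the Colombo–De Lellis–De Rosa range (`1/5 < 1/3`). [folklore] -/
theorem DeRosa2019_thm12.colomboDeLellisDeRosa (h : DeRosa2019_thm12) :
    ColomboDeLellisDeRosa2018_thm12 :=
  fun α hα hα5 => h α hα (hα5.trans (by norm_num))

/-- **Barrier (Colombo–De Lellis–De Rosa 2018 / De Rosa 2019): for weak dissipation the Leray–Hopf
class is not a uniqueness class.** For every `α ∈ (0, 1/3)` there is a divergence-free
`v̄ ∈ L²(𝕋³)` admitting infinitely many Leray solutions (distributional solutions with datum `v̄`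
in `L^∞(ℝ⁺;L²) ∩ L²_loc(ℝ⁺;H^α)` obeying the energy inequalities) of
`∂ₜv + div(v⊗v) + ∇p + (-Δ)^α v = 0`. Definitionally `DeRosa2019_thm12` (named fact, not proved
here). [cite: Derosa2018, §1 Thm. 1.2] [cite: ColomboDelellisDerosa2018, §1 Thm. 1.2]

BARRIER (structured block, D-0021):
- technique_class: leray-hopf-energy-inequality-selection, dissipation-exponent-insensitive-uniqueness-arguments, weak-solution-uniqueness-from-energy-class, compactness-plus-energy-inequality — arguments that would derive uniqueness (or a selection principle) for Leray–Hopf weak solutions from the ingredients of Leray's existence theory alone: the distributional formulation, the class `L^∞_t L²_x ∩ L²_t H^α_x` and the energy inequalities (2)–(3), which are available for every `α ∈ ]0,1[` [cite: ColomboDelellisDerosa2018, §1 Thm. 1.1 and (2)–(3)] [cite: Derosa2018, §1 Thm. 1.1]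
- blocks: any proof of uniqueness of Leray–Hopf solutions on `𝕋³` that does not use the strength of the dissipation beyond `α > 0` (it would contradict `DeRosa2019_thm12` at `α < 1/3`); in-tree, the uniqueness question for `α = 1` is the open `Literature.Analysis.FluidPDE.LerayHopfNonUniqueness` (ns.S19, conjectured non-uniqueness), and a uniqueness theorem for Leray–Hopf solutions would follow from global regularity of Leray–Hopf solutions via weak–strong uniqueness (in-tree `Literature.Analysis.FluidPDE.weak_strong_uniqueness`) — so exponent-blind energy-class arguments cannot deliver that route; the sources state the `α = 1` question as open/conjectural: "the authors [Jia–Šverák] have conjectured (and given strong evidence) that even Leray solutions of the classical Navier–Stokes equations (namely with `α = 1`) are not unique" [cite: ColomboDelellisDerosa2018, §1 p. 4] [cite: JiaSverak2015, Thm. 3 (conditional)] (audit 2026-08-16) PRECISELY: what is refuted is uniqueness of Leray solutions (CDLDR class: (2) from `0`, (3) from a.e. `s`) from a GENERAL divergence-free `L²` datum — in fact from some `C^β` datum, `α < β < 1/3`, a supercritical regime (`β + 2α < 1`) [cite: BulutHuynhPalasek2022, §1 (after Thm. 1)] in which the distinct solutions separate at times accumulating at `0` [cite: Derosa2018, §2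 p. 5 (property (v) of 𝓔_K)] — and, locally in time, even among continuous `C^β` solutions attaining the datum exactly and obeying the energy inequality for ALL `0 ≤ s ≤ t ≤ T` [cite: Derosa2018, §1 Thm. 1.2 (a)] [cite: ColomboDelellisDerosa2018, §1 Thm. 1.3 (c)] (companion theorems `HypodissipativeLerayNonuniquenessNarrow`, `HypodissipativeLerayNonuniquenessNarrow_local`); NOT blocked are exponent-blind energy arguments in the presence of a strong solution — weak–strong uniqueness by relative energy holds from the weak formulation and the energy inequality from `0` alone, with no dissipation at all [cite: Wiedemann2018, §2 Thm. 1] [cite: Gorini2023, §1 p. 2] — so the route "global regularity from smooth data ⇒ uniqueness of Leray–Hopf solutions from smooth data" is untouched at every `α` (the sentence above applies to rough data only), nor energy-based SELECTION principles (only non-uniqueness is printed; every admissible energy profile is realised from the wild datum [cite: Derosa2018, §2 Thm. 2.1], no rule is shown non-selective).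
- because: convex integration (De Lellis–Székelyhidi; the `C^{1/3-}` scheme of Buckmaster–De Lellis–Székelyhidi–Vicol after Isett) survives a sufficiently weak dissipative term: for `α < 1/5` [cite: ColomboDelellisDerosa2018, §1 Thms. 1.2–1.3] and for `α < 1/3` [cite: Derosa2018, §1 Thm. 1.2] it produces, from one `C^β` datum, infinitely many Hölder solutions on `[0,T]` obeying the energy inequality (even strictly dissipating the total energy), continued to `[0,∞)` by Leray's theorem [cite: ColomboDelellisDerosa2018, §1 Thm. 1.1 and the paragraph after Thm. 1.3]
- evasions_known: strengthen the dissipation — for `θ ≥ 5/4` weak solutions exist, are unique and satisfy the energy equality (J.-L. Lions 1969) [cite: LuoTiti2020, §1]; impose a critical integrability class — weak–strong uniqueness / Prodi–Serrin (in-tree `Literature.Analysis.FluidPDE.weak_strong_uniqueness`, for `α = 1`); for `α = 1` itself no unforced non-uniqueness of Leray–Hopf solutions is known: the Buckmaster–Vicol solutions "do not even have finite energy dissipation … thus they are not of Leray–Hopf type" [cite: Derosa2018, §1 p. 3] [cite: BuckmasterVicol2019AnnMath, Thm. 1.2], while WITH a force Leray–Hopf non-uniqueness holds (in-tree `Literature.Analysis.FluidPDE.albritton_brue_colombo`,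 ns.S20) [cite: AlbrittonBrueColombo2022AnnMath, Thm. 1.2] (audit 2026-08-16) (a) data admitting a strong (`C¹`) solution on `[0,T]`: every admissible weak solution coincides with it there, for every `α ≥ 0` (relative energy) [cite: Wiedemann2018, §2 Thm. 1] — the wild data are necessarily outside this class; (b) local-energy-inequality / suitable-solution arguments are not exponent-blind — "If `s < 3/4` then it is not clear how one should interpret the local energy inequality … the existence of suitable weak solutions is not clear if `s ≤ 3/4`" [cite: KwonOzanski2022, §1 p. 6] — hence outside the class (neither blocked nor supported by the entry); (c) forced non-uniqueness now covers all orders: `Λ^β`, `β ∈ (0,2)`, on `ℝ²` [cite: AlbrittonColombo2023, Thm. 1.1], `α ∈ (1/2,5/4)` on `ℝ³` [cite: KhorMiaoSu2023, Thm. 1.2 and Rmk. 2], `α = 1` [cite: AlbrittonBrueColombo2022AnnMath, Thm. 1.2]; (d) for `α = 1` unforced: the computer-assisted, unrefereed claim of infinitely many suitable Leray–Hopf solutions from one `L²` datum [cite: HouWangYang2025, Thm. 1] (recorded at ns.S19; no named fact).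
- scope_caveats: (i) only `α < 1/3` is covered; nothing is asserted for `1/3 ≤ α`, in particular not for Navier–Stokes `α = 1` — for `1/3 ≤ γ < 1/2` the method gives infinitely many bounded-energy weak solutions "but (a priori) without any control on `e_tot`" [cite: Derosa2018, §1 p. 3], and uniqueness of Leray–Hopf solutions for `α = 1` remains open [cite: ColomboDelellisDerosa2018, §1 p. 4]; (ii) periodic domain `𝕋³`, viscosity `1`, specific constructed data (Hölder `C^β`), not arbitrary data [cite: Derosa2018, §1 Thm. 1.2]; (iii) the mechanism (convex integration) "is entirely different from" the Jia–Šverák instability scenario for `α = 1` [cite: ColomboDelellisDerosa2018, §1 p. 4]; (iv) De Rosa's refinements (a)–(b) are not transcribed in this file (CDLDR's Thm. 1.3 is `ColomboDeLellisDeRosa2018_thm13` of the sibling `…Proofs` file, discharged in `…CDLDRHolds`); the Lean statement uses the unit torus `(ℝ/ℤ)³` (symbol `(2π|k|)^{2α}`), equivalent to the printed `2π`-periodic setting by scaling (`FractionalNSTorus`, design notes); (v) (audit 2026-08-16) PROVED in the tree: `DeRosa2019_thm12_holds` (`…DeRosaHolds.lean`; standard axioms), via De Rosa's Thm. 2.1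 and CDLDR's Thm. 1.1, all discharged; (vi) (audit) unforced deterministic state of the art is still `α < 1/3` [cite: LangeRehmeierSchenke2024, §1 (State of the art: deterministic regime)], but inside that range the wild `C^β` data are `L²`-dense, so "specific constructed data" in (ii) reads "an `L²`-dense set of `C^β` data" [cite: Gorini2023, §1 Cor. and Thm. (density of wild initial data)]; (vii) (audit) the in-tree open problem ns.S19 (`LerayHopfNonUniqueness`) is posed on `ℝ³` with `L²` data, the entry on `𝕋³`; (viii) (audit) technique-class coverage is narrower than the tags — see `blocks:` (PRECISELY) and the companion `HypodissipativeLerayNonuniquenessNarrow.lean`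
- status: established; PROVED in the tree (`DeRosa2019_thm12_holds`); claimed coverage narrowed by the audit of 2026-08-16 (`HypodissipativeLerayNonuniquenessNarrow.lean`) -/
def HypodissipativeLerayNonuniqueness : Prop :=
  DeRosa2019_thm12

/-- The catalogue entry is De Rosa's theorem, by definition. [cite: Derosa2018, §1 Thm. 1.2] -/
theorem hypodissipativeLerayNonuniqueness_iff :
    HypodissipativeLerayNonuniqueness ↔ DeRosa2019_thm12 :=
  Iff.rfl

/-- Consequence: for each `α ∈ (0, 1/3)` the Leray class is not a uniqueness class — there are a
datum and two Leray solutions from it that are not a.e. equal on `(0,∞) × 𝕋³`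
(`∫₀^∞∫‖v - w‖² ≠ 0`). [cite: Derosa2018, §1 Thm. 1.2] -/
theorem HypodissipativeLerayNonuniqueness.exists_two (h : HypodissipativeLerayNonuniqueness)
    {α : ℝ} (hα : 0 < α) (hα3 : α < 1 / 3) :
    ∃ (u₀ : 𝕋³ → ℝ³) (v w : ℝ → 𝕋³ → ℝ³), Literature.Analysis.FluidPDE.Torus.IsLerayFracSolution α u₀ v ∧
      Literature.Analysis.FluidPDE.Torus.IsLerayFracSolution α u₀ w ∧ ∫⁻ t in Ioi 0, Literature.Analysis.FluidPDE.Torus.eL2NormSq (v t - w t) ≠ 0 := by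
  obtain ⟨u₀, -, -, v, hv, hdist⟩ := h α hα hα3
  exact ⟨u₀, v 0, v 1, hv 0, hv 1, hdist 0 1 (by norm_num)⟩

end Literature.Barriers.NavierStokesRegularity
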